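import Summits.Ventures.DiscreteObjects.UnitDistance.ForcedPairTransport
import HarnessLib

/-!
# Distance-two forcing: a finite gadget with a forced bichromatic pair at distance `2` makes `ℚ(√d)²` non-3-colourable for `d ≡ 11 (mod 12)`
(cell `pub-namedobj`, target (U), seat udg g27)

Framing (verbatim for the cell): lottery ticket; floor = certified bounds/negative ranges.

A 3-colour companion to udg g22's `ForcedPairTransport.lean` (there: `Fin 4`).  Two elementary steps.

* TRANSPORT FOR ANY COLOUR TYPE (`pairs_ne_of_forced_ne_gen`): if a finite configuration `S ⊆ K²` contains points `P ≠ Q` that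
  receive different colours in EVERY proper `γ`-colouring of the unit-distance graph on `S`, then every pair `p, q ∈ K²` with
  `dist p q = dist P Q` is bichromatic in every proper `γ`-colouring of `K²` (the `K`-rational rotation of udg g22 moves `S`).
* DISTANCE TWO, THREE COLOURS (`not_colorable_three_of_dist_two_bichromatic`): let `K ∋ r` with `r² = 12k − 1`, `k ≥ 1`
  (e.g. `r = √d`, `d ≡ 11 (mod 12)`).  If in a proper `3`-colouring `C` of `K²` all pairs at distance `2` are bichromatic, then on
  every line `p, p+u, p+2u, p+3u` (`u` a unit vector of `K²`) the colours of `p, p+u, p+2u` are pairwise distinct and so are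
  those of `p+u, p+2u, p+3u`, whence `C (p + 3u) = C p` (`period_three`); but `(1, 0) = 2k·(3, 0) − k·(3s) − k·(3s̄)` for the
  unit vector `s = ((6k−1)/(6k), r/(6k))` (`(6k−1)² + r² = 36k²`), so `C (0,0) = C (1,0)` for two points at distance `1`.
* Also the forced-EQUAL + spindle version for any colour type (`not_colorable_of_forced_eq_gen`).
* COMBINED (`not_colorable_three_of_dist_two_forced`): ONE finite unit-distance graph in `K²` with a pair at distance `2` forced
  bichromatic in all its proper `3`-colourings gives `χ(K²) ≥ 4`.  Instance: `PlaneSqrt251Four.lean` (`χ(ℚ(√251)²) = 4`).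

Elementary; ours; nothing here is literature.  The gadgets are kernel-checked finite facts in their own files.
-/

noncomputable section

namespace Summit.Ventures.DiscreteObjects.UnitDistance

open SimpleGraph ForcedPair

namespace ForcedPair

/-- TRANSPORT (any colour type): a proper colouring of `K²` pulled back along the `K`-rational isometry `rotMove P p α β` is a proper
colouring of any configuration `S ⊆ K²`. -/
def pullbackGen {γ : Type*} {K : IntermediateField ℚ ℝ} (C : (planeUnitDistanceGraph.induce (fieldPoints K)).Coloring γ)
    (S : Set Pt) (hS : S ⊆ fieldPoints K) {P p : Pt} {α β : ℝ} (hα : α ∈ K) (hβ : β ∈ K) (hαβ : α ^ 2 + β ^ 2 = 1)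
    (hP : P ∈ fieldPoints K) (hp : p ∈ fieldPoints K) : (planeUnitDistanceGraph.induce S).Coloring γ :=
  Coloring.mk (fun v => C ⟨rotMove P p α β v, rotMove_mem hα hβ hP hp (hS v.2)⟩) fun {v w} hvw => by
    apply C.valid
    show dist (rotMove P p α β v) (rotMove P p α β w) = 1
    rw [dist_rotMove P p hαβ]
    exact hvw

/-- Value of the pulled-back colouring. -/
theorem pullbackGen_apply {γ : Type*} {K : IntermediateField ℚ ℝ}
    (C : (planeUnitDistanceGraph.induce (fieldPoints K)).Coloring γ)
    (S : Set Pt) (hS : S ⊆ fieldPoints K) {P p : Pt} {α β : ℝ} (hα : α ∈ K) (hβ : β ∈ K) (hαβ : α ^ 2 + β ^ 2 = 1)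
    (hP : P ∈ fieldPoints K) (hp : p ∈ fieldPoints K) (v : S) :
    pullbackGen C S hS hα hβ hαβ hP hp v = C ⟨rotMove P p α β v, rotMove_mem hα hβ hP hp (hS v.2)⟩ := rfl

end ForcedPair

/-- FORCED-DIFFERENT PAIRS TRANSPORT, any colour type.  If `S ⊆ K²` contains `P ≠ Q` with `C' P ≠ C' Q` for EVERY proper
`γ`-colouring `C'` of the unit-distance graph on `S`, then every pair `p, q ∈ K²` with `dist p q = dist P Q` is bichromatic in every
proper `γ`-colouring of `K²`. -/
theorem pairs_ne_of_forced_ne_gen {γ : Type*} (K : IntermediateField ℚ ℝ) (S : Set Pt) (hS : S ⊆ fieldPoints K) {P Q : Pt}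
    (hPS : P ∈ S) (hQS : Q ∈ S) (hPQ : P ≠ Q)
    (hforced : ∀ C' : (planeUnitDistanceGraph.induce S).Coloring γ, C' ⟨P, hPS⟩ ≠ C' ⟨Q, hQS⟩)
    (C : (planeUnitDistanceGraph.induce (fieldPoints K)).Coloring γ) (p q : fieldPoints K)
    (hd : dist (p : Pt) q = dist P Q) : C p ≠ C q := by
  obtain ⟨hα, hβ⟩ := alphaOf_mem (hS hPS) (hS hQS) p.2 q.2
  have hαβ := alpha_sq_add_beta_sq hPQ hd
  have h := hforced (pullbackGen C S hS hα hβ hαβ (hS hPS) p.2)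
  rw [pullbackGen_apply, pullbackGen_apply] at h
  have e1 : (⟨rotMove P p (alphaOf P Q p q) (betaOf P Q p q) P, rotMove_mem hα hβ (hS hPS) p.2 (hS hPS)⟩ : fieldPoints K) = p :=
    Subtype.ext (rotMove_base P p _ _)
  have e2 : (⟨rotMove P p (alphaOf P Q p q) (betaOf P Q p q) Q, rotMove_mem hα hβ (hS hPS) p.2 (hS hQS)⟩ : fieldPoints K) = q :=
    Subtype.ext (rotMove_apply_Q hPQ)
  rwa [e1, e2] at h

/-- FORCED-EQUAL PAIR + SPINDLE, any colour type.  If `S ⊆ K²` contains `P, Q` with `C' P = C' Q` for every proper `γ`-colouring `C'` of the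
unit-distance graph on `S`, and `K²` contains `Y` with `dist P Y = dist P Q` and `dist Q Y = 1` (i.e. `4·dist(P,Q)² − 1` is a square in `K`),
then `K²` has no proper `γ`-colouring at all (udg g22's `not_colorable_four_of_forced_eq`, verbatim for any `γ`). -/
theorem not_colorable_of_forced_eq_gen {γ : Type*} (K : IntermediateField ℚ ℝ) (S : Set Pt) (hS : S ⊆ fieldPoints K) {P Q : Pt}
    (hPS : P ∈ S) (hQS : Q ∈ S) (hPQ : P ≠ Q)
    (hforced : ∀ C' : (planeUnitDistanceGraph.induce S).Coloring γ, C' ⟨P, hPS⟩ = C' ⟨Q, hQS⟩)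
    {Y : Pt} (hY : Y ∈ fieldPoints K) (hPY : dist P Y = dist P Q) (hQY : dist Q Y = 1)
    (C : (planeUnitDistanceGraph.induce (fieldPoints K)).Coloring γ) : False := by
  obtain ⟨hα, hβ⟩ := alphaOf_mem (hS hPS) (hS hQS) (hS hPS) hY
  have hαβ := alpha_sq_add_beta_sq hPQ hPY
  have h1 := hforced (pullbackGen C S hS hα hβ hαβ (hS hPS) (hS hPS))
  rw [pullbackGen_apply, pullbackGen_apply] at h1
  have e1 : (⟨rotMove P P (alphaOf P Q P Y) (betaOf P Q P Y) P, rotMove_mem hα hβ (hS hPS) (hS hPS) (hS hPS)⟩ : fieldPoints K)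
      = ⟨P, hS hPS⟩ := Subtype.ext (rotMove_base P P _ _)
  have e2 : (⟨rotMove P P (alphaOf P Q P Y) (betaOf P Q P Y) Q, rotMove_mem hα hβ (hS hPS) (hS hPS) (hS hQS)⟩ : fieldPoints K)
      = ⟨Y, hY⟩ := Subtype.ext (rotMove_apply_Q hPQ)
  rw [e1, e2] at h1
  have hone : (1 : ℝ) ∈ K := one_mem K
  have hzero : (0 : ℝ) ∈ K := zero_mem K
  have h10 : (1 : ℝ) ^ 2 + (0 : ℝ) ^ 2 = 1 := by norm_num
  have h0 := hforced (pullbackGen C S hS hone hzero h10 (hS hPS) (hS hPS))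
  rw [pullbackGen_apply, pullbackGen_apply] at h0
  have id_apply : ∀ v : Pt, rotMove P P 1 0 v = v := by
    intro v; ext i; fin_cases i <;> simp [rotMove]
  have e3 : (⟨rotMove P P 1 0 P, rotMove_mem hone hzero (hS hPS) (hS hPS) (hS hPS)⟩ : fieldPoints K) = ⟨P, hS hPS⟩ :=
    Subtype.ext (id_apply P)
  have e4 : (⟨rotMove P P 1 0 Q, rotMove_mem hone hzero (hS hPS) (hS hPS) (hS hQS)⟩ : fieldPoints K) = ⟨Q, hS hQS⟩ :=
    Subtype.ext (id_apply Q)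
  rw [e3, e4] at h0
  have hadj : (planeUnitDistanceGraph.induce (fieldPoints K)).Adj ⟨Q, hS hQS⟩ ⟨Y, hY⟩ := by
    show dist Q Y = 1
    exact hQY
  exact C.valid hadj (h0.symm.trans h1)

/-! ## Lines of unit steps and the period `3` -/

/-- The point `(x + t a, y + t b)`. -/
def linePt (x y a b t : ℝ) : Pt := !₂[x + t * a, y + t * b]

/-- Coordinates of `linePt`. -/
@[simp] theorem linePt_apply_zero (x y a b t : ℝ) : linePt x y a b t 0 = x + t * a := by simp [linePt]

/-- Coordinates of `linePt`. -/
@[simp] theorem linePt_apply_one (x y a b t : ℝ) : linePt x y a b t 1 = y + t * b := by simp [linePt]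

/-- Distances along a unit line: `dist (p + t u) (p + t' u) = |t − t'|` for `|u| = 1`. -/
theorem dist_linePt {x y a b : ℝ} (hu : a ^ 2 + b ^ 2 = 1) (t t' : ℝ) :
    dist (linePt x y a b t) (linePt x y a b t') = |t - t'| := by
  have h2 : dist (linePt x y a b t) (linePt x y a b t') ^ 2 = (t - t') ^ 2 := by
    rw [dist_sq, linePt_apply_zero, linePt_apply_zero, linePt_apply_one, linePt_apply_one]
    linear_combination (t - t') ^ 2 * hu
  have h3 : dist (linePt x y a b t) (linePt x y a b t') ^ 2 = |t - t'| ^ 2 := by rw [h2, sq_abs]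
  exact (pow_left_inj₀ dist_nonneg (abs_nonneg _) two_ne_zero).1 h3

/-- Points of a `K`-rational line are in `K²`. -/
theorem linePt_mem {K : IntermediateField ℚ ℝ} {x y a b : ℝ} (hx : x ∈ K) (hy : y ∈ K) (ha : a ∈ K) (hb : b ∈ K)
    {t : ℝ} (ht : t ∈ K) : linePt x y a b t ∈ fieldPoints K := by
  intro i
  fin_cases i
  · show linePt x y a b t 0 ∈ K
    rw [linePt_apply_zero]; exact add_mem hx (mul_mem ht ha)
  · show linePt x y a b t 1 ∈ K
    rw [linePt_apply_one]; exact add_mem hy (mul_mem ht hb)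

/-- Three colours on a line: four consecutive unit-spaced points with all unit pairs AND all distance-`2` pairs bichromatic have
`colour 3 = colour 0`. -/
theorem fin3_period (c0 c1 c2 c3 : Fin 3) (h01 : c0 ≠ c1) (h02 : c0 ≠ c2) (h12 : c1 ≠ c2) (h13 : c1 ≠ c3) (h23 : c2 ≠ c3) :
    c3 = c0 := by
  fin_cases c0 <;> fin_cases c1 <;> fin_cases c2 <;> fin_cases c3 <;> simp_all

/-- PERIOD THREE.  In a proper `3`-colouring of `K²` in which every pair at distance `2` is bichromatic, `C (p + (t+3) u) = C (p + t u)`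
along every `K`-rational unit line. -/
theorem period_three {K : IntermediateField ℚ ℝ} (C : (planeUnitDistanceGraph.induce (fieldPoints K)).Coloring (Fin 3))
    (h2 : ∀ p q : fieldPoints K, dist (p : Pt) q = 2 → C p ≠ C q)
    {x y a b : ℝ} (hx : x ∈ K) (hy : y ∈ K) (ha : a ∈ K) (hb : b ∈ K) (hu : a ^ 2 + b ^ 2 = 1)
    {t : ℝ} (ht : t ∈ K) :
    C ⟨linePt x y a b (t + 3), linePt_mem hx hy ha hb (add_mem ht (ofNat_mem K 3))⟩ =
      C ⟨linePt x y a b t, linePt_mem hx hy ha hb ht⟩ := by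
  have ht1 : t + 1 ∈ K := add_mem ht (one_mem K)
  have ht2 : t + 2 ∈ K := add_mem ht (ofNat_mem K 2)
  have ht3 : t + 3 ∈ K := add_mem ht (ofNat_mem K 3)
  -- unit pairs
  have u01 : C ⟨_, linePt_mem hx hy ha hb ht⟩ ≠ C ⟨_, linePt_mem hx hy ha hb ht1⟩ :=
    C.valid (show dist (linePt x y a b t) (linePt x y a b (t + 1)) = 1 by rw [dist_linePt hu]; norm_num)
  have u12 : C ⟨_, linePt_mem hx hy ha hb ht1⟩ ≠ C ⟨_, linePt_mem hx hy ha hb ht2⟩ :=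
    C.valid (show dist (linePt x y a b (t + 1)) (linePt x y a b (t + 2)) = 1 by rw [dist_linePt hu]; norm_num)
  have u23 : C ⟨_, linePt_mem hx hy ha hb ht2⟩ ≠ C ⟨_, linePt_mem hx hy ha hb ht3⟩ :=
    C.valid (show dist (linePt x y a b (t + 2)) (linePt x y a b (t + 3)) = 1 by rw [dist_linePt hu]; norm_num)
  -- distance-2 pairs
  have d02 : C ⟨_, linePt_mem hx hy ha hb ht⟩ ≠ C ⟨_, linePt_mem hx hy ha hb ht2⟩ :=
    h2 _ _ (show dist (linePt x y a b t) (linePt x y a b (t + 2)) = 2 by rw [dist_linePt hu]; norm_num)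
  have d13 : C ⟨_, linePt_mem hx hy ha hb ht1⟩ ≠ C ⟨_, linePt_mem hx hy ha hb ht3⟩ :=
    h2 _ _ (show dist (linePt x y a b (t + 1)) (linePt x y a b (t + 3)) = 2 by rw [dist_linePt hu]; norm_num)
  exact fin3_period _ _ _ _ u01 d02 u12 d13 u23

/-- Iterated period: `C (p + (t + 3n) u) = C (p + t u)` for every `n : ℕ`. -/
theorem period_three_iter {K : IntermediateField ℚ ℝ} (C : (planeUnitDistanceGraph.induce (fieldPoints K)).Coloring (Fin 3))
    (h2 : ∀ p q : fieldPoints K, dist (p : Pt) q = 2 → C p ≠ C q)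
    {x y a b : ℝ} (hx : x ∈ K) (hy : y ∈ K) (ha : a ∈ K) (hb : b ∈ K) (hu : a ^ 2 + b ^ 2 = 1)
    {t : ℝ} (ht : t ∈ K) (n : ℕ) :
    C ⟨linePt x y a b (t + 3 * n), linePt_mem hx hy ha hb (add_mem ht (mul_mem (ofNat_mem K 3) (natCast_mem K n)))⟩ =
      C ⟨linePt x y a b t, linePt_mem hx hy ha hb ht⟩ := by
  induction n with
  | zero =>
      congr 2
      push_cast; ring
  | succ n ih =>
      have htn : t + 3 * n ∈ K := add_mem ht (mul_mem (ofNat_mem K 3) (natCast_mem K n))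
      have step := period_three C h2 hx hy ha hb hu htn
      have key : C ⟨linePt x y a b (t + 3 * ((n + 1 : ℕ) : ℝ)),
            linePt_mem hx hy ha hb (add_mem ht (mul_mem (ofNat_mem K 3) (natCast_mem K (n + 1))))⟩ =
          C ⟨linePt x y a b (t + 3 * n + 3), linePt_mem hx hy ha hb (add_mem htn (ofNat_mem K 3))⟩ := by
        congr 2; push_cast; ring
      rw [key, step, ih]

/-! ## The contradiction for `r² = 12k − 1` -/

/-- NO PROPER `3`-COLOURING OF `K²` HAS ALL DISTANCE-`2` PAIRS BICHROMATIC, when `K ∋ r` with `r² = 12k − 1`, `k ≥ 1`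
(`r = √d`, `d ≡ 11 (mod 12)`).  The unit vector `s = ((6k−1)/(6k), r/(6k))` gives `(1,0) = 2k·(3,0) − k·3s − k·3s̄`. -/
theorem not_colorable_three_of_dist_two_bichromatic (K : IntermediateField ℚ ℝ) {r : ℝ} (hr : r ∈ K) (k : ℕ) (hk : 1 ≤ k)
    (hrk : r ^ 2 = 12 * k - 1)
    (C : (planeUnitDistanceGraph.induce (fieldPoints K)).Coloring (Fin 3))
    (h2 : ∀ p q : fieldPoints K, dist (p : Pt) q = 2 → C p ≠ C q) : False := by
  have hk0 : (k : ℝ) ≠ 0 := by exact_mod_cast (show k ≠ 0 by omega)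
  have h6k : (6 * k : ℝ) ≠ 0 := by positivity
  -- the unit vector -s = (-(6k-1)/(6k), -r/(6k)) and -s̄ = (-(6k-1)/(6k), r/(6k))
  set a : ℝ := -((6 * k - 1) / (6 * k)) with ha_def
  set b : ℝ := -(r / (6 * k)) with hb_def
  have ha : a ∈ K := neg_mem (div_mem (sub_mem (mul_mem (ofNat_mem K 6) (natCast_mem K k)) (one_mem K))
    (mul_mem (ofNat_mem K 6) (natCast_mem K k)))
  have hb : b ∈ K := neg_mem (div_mem hr (mul_mem (ofNat_mem K 6) (natCast_mem K k)))
  have hb' : -b ∈ K := neg_mem hb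
  have hunit : a ^ 2 + b ^ 2 = 1 := by
    rw [ha_def, hb_def]; field_simp; linear_combination hrk
  have hunit' : a ^ 2 + (-b) ^ 2 = 1 := by linear_combination hunit
  have h0 : (0 : ℝ) ∈ K := zero_mem K
  have h1 : (1 : ℝ) ∈ K := one_mem K
  -- line 1: from (0,0) along (1,0): C (6k, 0) = C (0, 0)
  have L1 := period_three_iter C h2 h0 h0 h1 h0 (by norm_num) h0 (2 * k)
  -- line 2: from (6k, 0) along -s, k steps of 3: reaches ((6k+1)/2, -r/2)
  have hx2 : (6 * k : ℝ) ∈ K := mul_mem (ofNat_mem K 6) (natCast_mem K k)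
  have L2 := period_three_iter C h2 hx2 h0 ha hb hunit h0 k
  -- line 3: from ((6k+1)/2, -r/2) along -s̄, k steps: reaches (1, 0)
  have hx3 : ((6 * k + 1) / 2 : ℝ) ∈ K := div_mem (add_mem hx2 h1) (ofNat_mem K 2)
  have hy3 : (-(r / 2) : ℝ) ∈ K := neg_mem (div_mem hr (ofNat_mem K 2))
  have L3 := period_three_iter C h2 hx3 hy3 ha hb' hunit' h0 k
  -- identify the points
  have e10 : linePt 0 0 1 0 (0 + 3 * ((2 * k : ℕ) : ℝ)) = linePt (6 * k) 0 a b 0 := by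
    ext i; fin_cases i
    · simp [linePt]; ring
    · simp [linePt]
  have e21 : linePt (6 * k) 0 a b (0 + 3 * (k : ℝ)) = linePt ((6 * k + 1) / 2) (-(r / 2)) a (-b) 0 := by
    ext i; fin_cases i
    · simp [linePt, ha_def]; field_simp; ring
    · simp [linePt, hb_def]; field_simp; ring
  have e32 : linePt ((6 * k + 1) / 2) (-(r / 2)) a (-b) (0 + 3 * (k : ℝ)) = linePt 0 0 1 0 1 := by
    ext i; fin_cases i
    · simp [linePt, ha_def]; field_simp; ring
    · simp [linePt, hb_def]; field_simp; ring
  have hm00 : linePt 0 0 1 0 0 ∈ fieldPoints K := linePt_mem h0 h0 h1 h0 h0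
  have hm01 : linePt 0 0 1 0 1 ∈ fieldPoints K := linePt_mem h0 h0 h1 h0 h1
  -- chain the equalities of colours
  have c1 : C ⟨linePt (6 * k) 0 a b 0, linePt_mem hx2 h0 ha hb h0⟩ = C ⟨linePt 0 0 1 0 0, hm00⟩ := by
    rw [← L1]; congr 2; exact e10.symm
  have c2 : C ⟨linePt ((6 * k + 1) / 2) (-(r / 2)) a (-b) 0, linePt_mem hx3 hy3 ha hb' h0⟩ =
      C ⟨linePt (6 * k) 0 a b 0, linePt_mem hx2 h0 ha hb h0⟩ := by
    rw [← L2]; congr 2; exact e21.symm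
  have c3 : C ⟨linePt 0 0 1 0 1, hm01⟩ = C ⟨linePt ((6 * k + 1) / 2) (-(r / 2)) a (-b) 0, linePt_mem hx3 hy3 ha hb' h0⟩ := by
    rw [← L3]; congr 2; exact e32.symm
  have hadj : (planeUnitDistanceGraph.induce (fieldPoints K)).Adj ⟨linePt 0 0 1 0 0, hm00⟩ ⟨linePt 0 0 1 0 1, hm01⟩ := by
    show dist (linePt 0 0 1 0 0) (linePt 0 0 1 0 1) = 1
    rw [dist_linePt (by norm_num)]; norm_num
  exact C.valid hadj (c3.trans (c2.trans c1)).symm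

/-- DISTANCE-TWO FORCING.  `K ∋ r`, `r² = 12k − 1`, `k ≥ 1`.  If a configuration `S ⊆ K²` contains `P, Q` at distance `2` that receive
different colours in every proper `3`-colouring of the unit-distance graph on `S`, then `K²` is not `3`-colourable. -/
theorem not_colorable_three_of_dist_two_forced (K : IntermediateField ℚ ℝ) {r : ℝ} (hr : r ∈ K) (k : ℕ) (hk : 1 ≤ k)
    (hrk : r ^ 2 = 12 * k - 1) (S : Set Pt) (hS : S ⊆ fieldPoints K) {P Q : Pt} (hPS : P ∈ S) (hQS : Q ∈ S)
    (hPQ : dist P Q = 2)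
    (hforced : ∀ C' : (planeUnitDistanceGraph.induce S).Coloring (Fin 3), C' ⟨P, hPS⟩ ≠ C' ⟨Q, hQS⟩) :
    ¬ (planeUnitDistanceGraph.induce (fieldPoints K)).Colorable 3 := by
  rintro ⟨C⟩
  have hne : P ≠ Q := by
    intro h; rw [h, dist_self] at hPQ; norm_num at hPQ
  refine not_colorable_three_of_dist_two_bichromatic K hr k hk hrk C ?_
  intro p q hpq
  exact pairs_ne_of_forced_ne_gen K S hS hPS hQS hne hforced C p q (hpq.trans hPQ.symm)

end Summit.Ventures.DiscreteObjects.UnitDistance
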